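import Literature.AlgebraicGeometry.AbelianSchemes.AbelianSchemeConstSubgroupQuotient
import Literature.AlgebraicGeometry.Morphisms.SmoothOfFlatSurjectiveSmoothSource
import Literature.AlgebraicGeometry.Morphisms.FlatOfComp
import Literature.AlgebraicGeometry.RelativeSpec.GeometricQuotientFreeFlat
import HarnessLib

/-!
# The quotient `A/K` of an abelian scheme by a free finite group of translations is flat and SMOOTH over the base

For an abelian scheme `A → S`, a finite subgroup `K ⊂ A(S)` of sections whose non-trivial translations fix no
geometric point (`hfree`), and Mumford's glued quotient `A/K → S` (`AbelianSchemeOver.quotientOver`, with quotient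
map `ψ = quotientMk : A → A/K`), this file discharges the smoothness hypothesis `hsm : Smooth (A.quotientOver u K).hom`
of the assembly `AbelianSchemeOver.quotientBy` of `AbelianSchemes/AbelianSchemeConstSubgroupQuotient`:

* `flat_quotientMk_left` — `ψ` is flat (an affine geometric quotient by a FREE finite group action is flat:
  `RelativeSpec.ActionOver.IsGeometricQuotient.flat_of_free`, Mumford §12 Thm. 1);
* `flat_quotientOver_hom` — `A/K → S` is flat: `ψ` is flat and surjective and `ψ ≫ (A/K → S) = (A → S)` is smooth,
  and flatness descends along a flat surjective morphism on the source (`Morphisms.Flat.of_comp_of_surjective`,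
  EGA IV₂ 2.2.11 (iii) / Stacks Tag 02JZ);
* `locallyOfFiniteType_quotientOver_hom`, `locallyOfFinitePresentation_quotientOver_hom` — `A/K → S` is proper, hence
  locally of finite type, hence locally of finite presentation over a locally Noetherian base;
* `smooth_quotientOver_hom` — **`A/K → S` is smooth** over a locally Noetherian base with perfect residue fields, by
  descent of smoothness along the flat surjective `ψ` (`Morphisms.smooth_of_flat_surjective_of_smooth_comp`: EGA IV₄
  17.7.7 through the regular-fibre criterion 17.5.1 / Stacks Tag 01V8), and `smooth_quotientOver_hom_of_hom_spec` — the
  same over any field of characteristic `0` (the case of a smooth quasi-projective `ℂ`-scheme `S`).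

## References

* [MumfordAV1970] D. Mumford, *Abelian Varieties* (1970), §7 Thm. p. 66 and Thm. 4 (p. 72); §12 Thm. 1 (p. 112).
* [Grothendieck1967] A. Grothendieck, EGA IV₄, Prop. 17.7.7, Thm. 17.5.1.
* [StacksProject] The Stacks Project, Tag 02JZ, Tag 01V8.
* [SGA1] A. Grothendieck, SGA 1, Exp. V Prop. 1.1, Cor. 1.5.
-/

noncomputable section

universe u

open CategoryTheory CategoryTheory.Limits AlgebraicGeometry MonoidalCategory CartesianMonoidalCategory
open scoped MonObj

namespace Literature.AlgebraicGeometry.AbelianSchemes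

namespace AbelianSchemeOver

section Smooth

variable {S : Scheme.{u}} (A : AbelianSchemeOver S) {Y : Scheme.{u}} (u : S ⟶ Y) (K : Subgroup A.Sections)
  [Finite K] [Y.IsSeparated] [IsSeparated (A.X.hom ≫ u)] [S.IsSeparated]
  (hcov : ∀ x : A.left, ∃ O : (A.translationActionOver u K).StableAffineOpens, x ∈ O.1)

/-- **`ψ : A → A/K` is flat** for a finite subgroup `K` of sections none of whose non-trivial translations fixes a geometric point of
`A` (a free action, hypothesis `hfree`): an affine geometric quotient by a free finite group action is flat (Mumford §12 Thm. 1: `A` is a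
`K`-torsor over `A/K`). [cite: MumfordAV1970, §12 Thm. 1 (p. 112)] -/
theorem flat_quotientMk_left [IsAffine Y]
    (hfree : ∀ (Ω : Type u) [Field Ω] [IsAlgClosed Ω] (x : Spec (.of Ω) ⟶ A.left) (σ : K), σ ≠ 1 →
      x ≫ (A.translation (σ : A.Sections)).left ≠ x) :
    Flat (A.quotientMk u K hcov).left := by
  haveI := Fintype.ofFinite K
  haveI := A.isAffineHom_quotientMk_left u K hcov
  exact (A.isGeometricQuotient_quotientActionOver u K hcov).flat_of_free (A.quotientActionOver_free u K hcov hfree)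

/-- `ψ : A → A/K` is surjective (as a morphism property). [cite: MumfordAV1970, §7 Thm. p. 66 (1)] -/
theorem surjective_quotientMk_left : Surjective (A.quotientMk u K hcov).left :=
  ⟨A.quotientMk_left_surjective u K hcov⟩

include hcov in
/-- **`A/K → S` is flat**: `ψ` is flat and surjective and `ψ ≫ (A/K → S) = (A → S)` is smooth, hence flat, and
flatness descends along a flat surjective morphism on the source (EGA IV₂ 2.2.11 (iii) / Stacks 02JZ, ★
`Morphisms.Flat.of_comp_of_surjective`). [cite: StacksProject, Tag 02JZ] -/
theorem flat_quotientOver_hom [IsAffine Y]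
    (hfree : ∀ (Ω : Type u) [Field Ω] [IsAlgClosed Ω] (x : Spec (.of Ω) ⟶ A.left) (σ : K), σ ≠ 1 →
      x ≫ (A.translation (σ : A.Sections)).left ≠ x) :
    Flat (A.quotientOver u K).hom := by
  haveI := A.flat_quotientMk_left u K hcov hfree
  haveI := A.surjective_quotientMk_left u K hcov
  haveI : Flat ((A.quotientMk u K hcov).left ≫ (A.quotientOver u K).hom) := by
    rw [Over.w]
    haveI := A.isSmooth
    infer_instance
  exact Morphisms.Flat.of_comp_of_surjective (A.quotientMk u K hcov).left _

include hcov in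
/-- `A/K → S` is locally of finite type (it is proper). [cite: SGA1, Exp. V Cor. 1.5] -/
theorem locallyOfFiniteType_quotientOver_hom [LocallyOfFiniteType (A.X.hom ≫ u)] [IsLocallyNoetherian Y] :
    LocallyOfFiniteType (A.quotientOver u K).hom := by
  haveI := A.isProper_quotientOver_hom u K hcov
  infer_instance

/-- Over a locally Noetherian base, locally of finite type implies locally of finite presentation. [folklore] -/
private theorem locallyOfFinitePresentation_of_isLocallyNoetherian {X T : Scheme.{u}} (q : X ⟶ T)
    [LocallyOfFiniteType q] [IsLocallyNoetherian T] : LocallyOfFinitePresentation q := by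
  rw [HasRingHomProperty.iff_appLE (P := @LocallyOfFinitePresentation)]
  intro U V e
  haveI := IsLocallyNoetherian.component_noetherian (X := T) U
  exact RingHom.FinitePresentation.of_finiteType.mp
    (HasRingHomProperty.appLE @LocallyOfFiniteType q inferInstance U V e)

include hcov in
/-- `A/K → S` is locally of finite presentation over a locally Noetherian `S`. [cite: SGA1, Exp. V Cor. 1.5] -/
theorem locallyOfFinitePresentation_quotientOver_hom [LocallyOfFiniteType (A.X.hom ≫ u)] [IsLocallyNoetherian Y]
    [IsLocallyNoetherian S] : LocallyOfFinitePresentation (A.quotientOver u K).hom := by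
  haveI := A.locallyOfFiniteType_quotientOver_hom u K hcov
  exact locallyOfFinitePresentation_of_isLocallyNoetherian _

include hcov in
/-- **`A/K → S` is SMOOTH** (the smoothness input `hsm` of `quotientBy`) over a locally Noetherian base `S` with perfect residue
fields (e.g. any `ℚ`-scheme), for a finite subgroup `K` of sections acting freely on geometric points (`hfree`):
`ψ : A → A/K` is flat and surjective, `ψ ≫ (A/K → S) = (A → S)` is smooth, `A/K → S` is flat and locally of finite
presentation, and smoothness descends along a flat surjective morphism on the source in this generality (EGA IV₄
17.7.7 through the regular-fibre criterion 17.5.1 / Stacks 01V8, `Morphisms.smooth_of_flat_surjective_of_smooth_comp`).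
[cite: MumfordAV1970, §7 Thm. 4 (p. 72)] [cite: Grothendieck1967, Prop. 17.7.7] -/
theorem smooth_quotientOver_hom [IsAffine Y] [LocallyOfFiniteType (A.X.hom ≫ u)] [IsLocallyNoetherian Y]
    [IsLocallyNoetherian S]
    (hfree : ∀ (Ω : Type u) [Field Ω] [IsAlgClosed Ω] (x : Spec (.of Ω) ⟶ A.left) (σ : K), σ ≠ 1 →
      x ≫ (A.translation (σ : A.Sections)).left ≠ x)
    (hκ : ∀ s : S, PerfectField (S.residueField s)) : Smooth (A.quotientOver u K).hom := by
  haveI := A.flat_quotientMk_left u K hcov hfree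
  haveI := A.surjective_quotientMk_left u K hcov
  haveI := A.locallyOfFinitePresentation_quotientOver_hom u K hcov
  haveI := A.isSmooth
  exact Morphisms.smooth_of_flat_surjective_of_smooth_comp (A.quotientMk u K hcov).left (A.quotientOver u K).hom
    A.X.hom (Over.w _) fun q => hκ _

include hcov in
/-- **`A/K → S` is smooth over a field of characteristic `0`** (the line's case: `S` a smooth
quasi-projective `ℂ`- or `ℚ`-scheme): `A/K → S` is smooth. [cite: MumfordAV1970, §7 Thm. 4 (p. 72)]
[cite: Grothendieck1967, Prop. 17.7.7] -/
theorem smooth_quotientOver_hom_of_hom_spec {k : Type u} [Field k] [CharZero k] (hS : S ⟶ Spec (.of k)) [IsAffine Y]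
    [LocallyOfFiniteType (A.X.hom ≫ u)] [IsLocallyNoetherian Y] [IsLocallyNoetherian S]
    (hfree : ∀ (Ω : Type u) [Field Ω] [IsAlgClosed Ω] (x : Spec (.of Ω) ⟶ A.left) (σ : K), σ ≠ 1 →
      x ≫ (A.translation (σ : A.Sections)).left ≠ x) :
    Smooth (A.quotientOver u K).hom :=
  A.smooth_quotientOver_hom u K hcov hfree fun s => by
    haveI := Resolution.charZero_residueField_of_over_field hS s
    exact PerfectField.ofCharZero

end Smooth

end AbelianSchemeOver

end Literature.AlgebraicGeometry.AbelianSchemes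

end
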